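import Literature.NumberTheory.Rogawski1990.ArchSingularMembersPinRatioRational              -- ★ p844084 (W4g): `smul_one_of_coe_coe_cmRationalToArch_eq_smul_one` (+ ★ (W4c′) guard lemma, ★ (b0), ★ (W4e) behind it)
import Literature.NumberTheory.Rogawski1990.ArchSingularMembersOfRegularData                 -- ★ p843870 (W4e): `exists_rational_diagonal_frame`
import Literature.NumberTheory.Weil1964.UnitaryArchSingularCentralizerWallFrames              -- ★ p844161 (b5) FILE 2: `exists_isSingularArchFrame_archDiagTorus_wall'`
import Literature.NumberTheory.Weil1964.UnitaryArchSingularCentralizerTopFormHaarCoherence    -- ★ `exists_isSingularArchFrame_conj`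
import HarnessLib

/-!
# FRAMES ON THE WHOLE ARCHIMEDEAN STABLE CLASS of a non-central singular rational element («(b5)» FILE 3; Rogawski 1990 §3.8 Prop. 3.8.1 (a), §14.2, §14.5)

Topic `NumberTheory/Rogawski1990`; namespace `Literature.NumberTheory.Rogawski1990`.  THEOREMS ONLY (no `def`, no instance, no notation, no axiom, no named fact, no `sorry`).
Cell `pub/hodgecm-mathlib`, ENGINE T1 (crux H413 = `stmt-HodgeConjecture-24833`); the (ST-∞) witness road, brick (b5) (F0P3-p03 (g11); asked by F0P3a-p07 (g10) 11:59:17Z for ★ p844088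
(W6′)'s κ-block transport, (W7) map §3; LEAD F0P3a-plan (g10) WORD T9-22 (3)).  Count-neutral; HONEST LABEL: HC_CM is proved only modulo the printed citations until rung 0 closes.

WHAT.  `H′ ∈ M₃(L)` hermitian ANISOTROPIC (the inner form carrying the rational points).
* **`exists_isSingularArchFrame_of_guard`** — EVERY point `x ∈ G′_∞ = U(H′)(L⁺ ⊗ ℝ)` of the S1′ guard («`∃ γ₀ ∈ U(H′)(L⁺)` non-regular, `γ₀ ⊗ 1 ↔ x`») that is not a rational scalar
  `ζ ⊗ 1` admits a singular archimedean frame (★ `IsSingularArchFrame`).  Proof: a rational diagonal frame `c(P)ᵀ diag α′ P = H′` (★ (W4e), Landherr), the congruence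
  `Ψ : U(H′) ≃ U(diag α′)`; ★ (W4c′) `Ψ x = q·t(zw∘ρ)·q⁻¹` with `zw` of rational type; ★ (b5) FILE 2 frames `t(zw∘ρ)`; ★ `IsSingularArchFrame.conj` and ★ `.of_formCongr` along `Ψ⁻¹`
  (the congruence with `(P ⊗ 1)⁻¹`, whose value at `Ψ x` IS `x`).  ⇒ the «framed» guard of ★ (W4f) `exists_archSingularMembers_withData_of_universal_pinRatio` ((J-val-K-built), (W-a))
  holds at EVERY guard point off the centre, not only at the rational ones.
* **`exists_isSingularArchFrame_of_isStablyConj_cmRationalToArch`** — the same for every `x` stably conjugate to `γ₀ ⊗ 1`, `γ₀` rational non-regular non-scalar (the shape ★ (W6′)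
  reads: (κ-arch) sums over the whole archimedean stable class, and ★ `archSingularTopFormFamily` is non-junk exactly on framed classes).

## References
* [Rogawski1990] J. D. Rogawski, *Automorphic Representations of Unitary Groups in Three Variables*, Ann. of Math. Stud. 123 (1990), §3.8 Prop. 3.8.1 (a) p. 27; §14.2 p. 232;
  §14.5 Lemma 14.5.2 (b) pp. 238–239.
* [PlatonovRapinchuk1994] V. Platonov, A. Rapinchuk, *Algebraic Groups and Number Theory* (1994), §1.2, §2.3.
* [Landherr1936HermitianForms] W. Landherr, *Äquivalenz Hermitescher Formen über einem beliebigen algebraischen Zahlkörper*, Abh. Math. Sem. Hamburg 11 (1936).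
-/

set_option autoImplicit false

noncomputable section

open NumberField NumberField.InfinitePlace NumberField.mixedEmbedding Equiv Set
open Literature.NumberTheory.Automorphic
open Literature.NumberTheory.Automorphic.UnitaryGroup hiding hermForm
open Literature.AlgebraicGeometry.ShimuraVarieties (unitaryGroup hermForm)
open Literature.NumberTheory.Weil1964 Literature.NumberTheory.Weil1964.UnitaryArchTopForm
open scoped Matrix MatrixGroups

namespace Literature.NumberTheory.Rogawski1990

variable (L : Type) [Field L] [NumberField L] [IsCMField L] (H' : Matrix (Fin 3) (Fin 3) L)

/-- **FRAMES AT EVERY GUARD POINT OFF THE CENTRE.**  `H′` hermitian anisotropic; `x ∈ U(H′)(L⁺ ⊗ ℝ)` corresponding to a non-regular rational `γ₀ ∈ U(H′)(L⁺)` and not a rational scalar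
`ζ ⊗ 1`.  Then `x` admits a singular archimedean frame.  (Rational diagonal frame of `H′` ★ (W4e) → congruence `Ψ` → ★ (W4c′) guard lemma → ★ (b5) FILE 2 frame at the torus point →
★ conj ∕ ★ `of_formCongr` back along `Ψ⁻¹`.) [cite: Rogawski1990, §3.8 Prop. 3.8.1 (a) p. 27; §14.2 p. 232; §14.5 Lemma 14.5.2 (b) p. 239] [cite: PlatonovRapinchuk1994, §2.3] -/
theorem exists_isSingularArchFrame_of_guard (hherm : (H'.map (cmConjRingHom L))ᵀ = H')
    (hanis : ∀ x : Fin 3 → L, hermForm (cmConjRingHom L) H' x x = 0 → x = 0)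
    {x : arch (↥(maximalRealSubfield L)) L (IsCMField.complexConj L) 3 H'}
    (hx : ∃ γ₀ : (cmDatum L 3 H').Rational, ¬ IsRegularElt (γ₀.val : GL (Fin 3) L) ∧
      Corresponds (conjMixed (↥(maximalRealSubfield L)) L (IsCMField.complexConj L)) (archFormOf L 3 H') (archFormOf L 3 H') (cmRationalToArch L 3 H' γ₀) x)
    (hnc : ¬ ∃ ζ : L, ((x : GL (Fin 3) (mixedSpace L)) : Matrix (Fin 3) (Fin 3) (mixedSpace L)) = mixedEmbedding L ζ • (1 : Matrix (Fin 3) (Fin 3) (mixedSpace L))) :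
    ∃ (a b : L) (T : GL (Fin 3) (mixedSpace L)) (H_a : Matrix (Fin 2) (Fin 2) L) (H_b : Matrix (Fin 1) (Fin 1) L), IsSingularArchFrame L H' x a b T H_a H_b := by
  have hdet : H'.det ≠ 0 := Godement.det_ne_zero_of_anisotropic L H' hanis
  -- a rational diagonal frame of `H′` and the congruence `Ψ : U(H′) ≃ U(diag α′)`
  obtain ⟨α', P, hP, hα', hhermα⟩ := exists_rational_diagonal_frame L H' hherm hdet
  have hSA := formCongr_map_mixedEmbedding_archFormOf_eq L hP
  let Ψ : arch (↥(maximalRealSubfield L)) L (IsCMField.complexConj L) 3 H' ≃ₜ* arch (↥(maximalRealSubfield L)) L (IsCMField.complexConj L) 3 (Matrix.diagonal α') :=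
    unitaryGroupOfFormCongrOfEq (conjMixed (↥(maximalRealSubfield L)) L (IsCMField.complexConj L)) (Matrix.GeneralLinearGroup.map (mixedEmbedding L) P)
      (archFormOf L 3 (Matrix.diagonal α')) (archFormOf L 3 H') hSA
  have hΨ : ∀ g : arch (↥(maximalRealSubfield L)) L (IsCMField.complexConj L) 3 H', ((Ψ g : arch (↥(maximalRealSubfield L)) L (IsCMField.complexConj L) 3 (Matrix.diagonal α')) : GL (Fin 3) (mixedSpace L)) =
      Matrix.GeneralLinearGroup.map (mixedEmbedding L) P * (g : GL (Fin 3) (mixedSpace L)) * (Matrix.GeneralLinearGroup.map (mixedEmbedding L) P)⁻¹ := fun _ => rfl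
  -- `Ψ x` is a `U(diag α′)`-conjugate of a rational-type wall torus point (★ (W4c′))
  obtain ⟨zw, hw, hrat, ρ, q, hq⟩ := exists_conj_archDiagTorus_eq_archCongr_of_not_central L H' α' (Matrix.GeneralLinearGroup.map (mixedEmbedding L) P) Ψ hΨ
    hherm hanis hα' hhermα hx hnc
  -- frame at the torus point (★ (b5) FILE 2), carried to `Ψ x` by the conjugator
  obtain ⟨a, b, T, H_a, H_b, hf⟩ := exists_isSingularArchFrame_archDiagTorus_wall' L α' hα' hhermα zw hw hrat ρ
  have hfΨ : ∃ (a b : L) (T : GL (Fin 3) (mixedSpace L)) (H_a : Matrix (Fin 2) (Fin 2) L) (H_b : Matrix (Fin 1) (Fin 1) L),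
      IsSingularArchFrame L (Matrix.diagonal α') (Ψ x) a b T H_a H_b := by
    rw [← hq, MulAut.conj_apply]
    exact exists_isSingularArchFrame_conj _ q ⟨a, b, T, H_a, H_b, hf⟩
  -- back along `Ψ⁻¹`, the congruence with `(P ⊗ 1)⁻¹`, whose value at `Ψ x` is `x`
  have hS' : formCongr (conjMixed (↥(maximalRealSubfield L)) L (IsCMField.complexConj L)) (Matrix.GeneralLinearGroup.map (mixedEmbedding L) P)⁻¹ (archFormOf L 3 H') =
      archFormOf L 3 (Matrix.diagonal α') := by
    rw [← hSA]; exact formCongr_inv_formCongr _ _ _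
  obtain ⟨a', b', T', Ha', Hb', hf'⟩ := exists_isSingularArchFrame_archCongr (Matrix.GeneralLinearGroup.map (mixedEmbedding L) P)⁻¹ hS' (Ψ x) hfΨ
  have hx' : unitaryGroupOfFormCongrOfEq (conjMixed (↥(maximalRealSubfield L)) L (IsCMField.complexConj L)) (Matrix.GeneralLinearGroup.map (mixedEmbedding L) P)⁻¹
      (archFormOf L 3 H') (archFormOf L 3 (Matrix.diagonal α')) hS' (Ψ x) = x := by
    apply Subtype.ext
    rw [coe_unitaryGroupOfFormCongrOfEq_apply, hΨ]
    group
  rw [hx'] at hf'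
  exact ⟨a', b', T', Ha', Hb', hf'⟩

/-- **FRAMES ON THE WHOLE ARCHIMEDEAN STABLE CLASS** ((b5) as the κ-block transport ★ (W6′) reads it): `H′` hermitian anisotropic, `γ₀ ∈ U(H′)(L⁺)` non-regular and not a scalar;
every `x ∈ U(H′)(L⁺ ⊗ ℝ)` stably conjugate to `γ₀ ⊗ 1` admits a singular archimedean frame (`x` is not a rational scalar: a scalar `ζ ⊗ 1` is central, so `γ₀ ⊗ 1 = ζ ⊗ 1` and `γ₀ = ζ•1`
by ★ `smul_one_of_coe_coe_cmRationalToArch_eq_smul_one`). [cite: Rogawski1990, §3.8 Prop. 3.8.1 (a) p. 27; §14.2 p. 232; §14.5 Lemma 14.5.2 (b) p. 239] [cite: PlatonovRapinchuk1994, §2.3] -/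
theorem exists_isSingularArchFrame_of_isStablyConj_cmRationalToArch (hherm : (H'.map (cmConjRingHom L))ᵀ = H')
    (hanis : ∀ x : Fin 3 → L, hermForm (cmConjRingHom L) H' x x = 0 → x = 0)
    (γ₀ : (cmDatum L 3 H').Rational) (hnreg : ¬ IsRegularElt (γ₀.val : GL (Fin 3) L))
    (hnsc : ∀ ζ : L, (((γ₀ : unitaryGroup (cmConjRingHom L) H').val : GL (Fin 3) L) : Matrix (Fin 3) (Fin 3) L) ≠ ζ • (1 : Matrix (Fin 3) (Fin 3) L))
    {x : arch (↥(maximalRealSubfield L)) L (IsCMField.complexConj L) 3 H'}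
    (hst : IsStablyConj (conjMixed (↥(maximalRealSubfield L)) L (IsCMField.complexConj L)) (archFormOf L 3 H') (cmRationalToArch L 3 H' γ₀) x) :
    ∃ (a b : L) (T : GL (Fin 3) (mixedSpace L)) (H_a : Matrix (Fin 2) (Fin 2) L) (H_b : Matrix (Fin 1) (Fin 1) L), IsSingularArchFrame L H' x a b T H_a H_b := by
  refine exists_isSingularArchFrame_of_guard L H' hherm hanis ⟨γ₀, hnreg, corresponds_self_iff.2 hst⟩ ?_
  rintro ⟨ζ, hζ⟩
  refine hnsc ζ (smul_one_of_coe_coe_cmRationalToArch_eq_smul_one L H' γ₀ ?_)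
  -- `γ₀ ⊗ 1` is conjugate to the scalar `x = ζ ⊗ 1`, hence equal to it
  obtain ⟨g, hg⟩ := isConj_iff.1 hst
  have e : ((cmRationalToArch L 3 H' γ₀ : arch (↥(maximalRealSubfield L)) L (IsCMField.complexConj L) 3 H') : GL (Fin 3) (mixedSpace L)) =
      g⁻¹ * (x : GL (Fin 3) (mixedSpace L)) * g := by
    rw [← hg]; group
  rw [e, commute_of_coe_eq_smul_one hζ g⁻¹, inv_mul_cancel_right, hζ]

end Literature.NumberTheory.Rogawski1990

end
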